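import Literature.NumberTheory.EllipticCurves.CongruentNumberTwoDescentLocal
import Literature.NumberTheory.QuadraticForms.PadicHilbertSymbol
import HarnessLib

/-!
# Local solubility for the complete `2`-descent on `E_n`, `n` ODD: the place above `2`

Sequel of `CongruentNumberTwoDescentLocal.lean` (good primes, odd `ℓ ∥ n`, the real place, assembly, and the
prime `2` for `n ≡ 2 (mod 4)`). For ODD square-free `n` the local image `δ(E_n(ℚ₂))` of `E_n : y² = (x+n)x(x−n)`
has order `#E_n(ℚ₂)[2] · 2 = 8`, and its part with both coordinates ODD (`v₂(a) = v₂(b) = 0`) is the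
`4`-element group `{(1, 1), (n, −1), (5, 1), (5n, −1)}` modulo `ℚ₂ˣ²` — the descent pairs of `O`, `T₂ = (0, 0)`,
the `2`-adic point `G = (1/4, √(1 − 16n²)/8)` (Aoki 1999 Thm 3.1 (1): `x = 1/t²`, `t = 2`) and `G + T₂`. This file
exhibits them (Serre, *Cours d'arithmétique* II §3.3 Thm 4 as the square test, `res8`/`v₂` currency):

* `twoDescentClass_mem_selmerLocalKer_two_of_T₂_res8` — `([a]₂, [b]₂) = ([n], [−1])`: `res8 (a·n) = 1`,
  `res8 (−b) = 1` (the point `T₂`, descent values `(n, −n²)`);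
* `exists_mul_self_eq_two_odd` — the `2`-adic square root of `1 − 16n²` in `ℚ_v`, `v ∣ 2`;
* `twoDescentClass_mem_selmerLocalKer_two_of_G_res8` — `([a]₂, [b]₂) = ([5], [1])`: `res8 (a·(1 + 4n)) = 1`,
  `res8 b = 1` (the point `G`, descent values `(1/4 + n, 1/4) ≡ (1 + 4n, 1)`, `1 + 4n ≡ 5 (mod 8)`);
* `twoDescentClass_mem_selmerLocalKer_of_equation_add_T₂` (generic `ℚ`-field `E`, `CharZero` as a term): the
  exhibit `P + T₂` for an `E`-point `P = (x, y)` (descent values multiply: `((e₂−e₁)(x−e₁), (e₂−e₁)(e₂−e₃)(x−e₂))`);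
* `twoDescentClass_mem_selmerLocalKer_two_of_GT₂_res8` — `([a]₂, [b]₂) = ([5n], [−1])`: `res8 (a·n·(1+4n)) = 1`,
  `res8 (−b) = 1` (the point `G + T₂`).

Theorems only; no named fact. Cell `bsd-monsky` (prover-B): the `2`-adic input of the `≥` half of Monsky's
`2`-Selmer formula for odd `n` (`HeathBrown1994.monsky_card_selmerGroup_two_odd`; Heath-Brown 1993, Lemma 2:
"for the prime `p = 2` no further condition is required").

## References

* [SilvermanAEC2009] J. H. Silverman, *The Arithmetic of Elliptic Curves*, 2nd ed., Prop. X.1.4, Example X.1.5.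
* [Serre1973] J.-P. Serre, *A Course in Arithmetic*, Ch. II §3.3 Thm 4.
* [HeathBrown1994SelmerCongruentII] D. R. Heath-Brown, Invent. Math. 118 (1994), Appendix (P. Monsky),
  typescript p. 38 L17–L31 (odd `D`).
-/

noncomputable section

open scoped Classical

open WeierstrassCurve WeierstrassCurve.Affine WeierstrassCurve.Affine.Point
open Literature.NumberTheory.GaloisRepresentations
open Literature.NumberTheory.EllipticCurves.KramerTwoDescent
open Literature.NumberTheory.EllipticCurves.TwoDescentLocal
open Literature.NumberTheory.QuadraticForms
open IsDedekindDomain NumberField Rat.HeightOneSpectrum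

namespace Literature.NumberTheory.EllipticCurves

/-! ## §0 A generic exhibit: `P + T₂` -/

namespace TwoDescentLocal

/-- **Exhibit `P + T₂` ⟹ local condition** over a generic `ℚ`-field `E` (`CharZero` as a term): for an `E`-point
`P = (x, y)` of `E` with `x ≠ e₁, e₂`, the descent pair of `P + T₂` is
`((e₂−e₁)(x−e₁), (e₂−e₁)(e₂−e₃)(x−e₂))` (the descent map is a homomorphism, Silverman X.1.4); if `a` times the
first and `b` times the second are squares in `E`, then `c(a, b)` lies in the local Selmer kernel at `E`.
[cite: SilvermanAEC2009, Prop. X.1.4, Prop. X.4.9] -/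
theorem twoDescentClass_mem_selmerLocalKer_of_equation_add_T₂ (W : WeierstrassCurve ℚ) [W.IsElliptic]
    {e₁ e₂ e₃ : ℚ} (h : W.toAffine.SplitTwoTorsion e₁ e₂ e₃) (E : Type) [Field E] [Algebra ℚ E]
    (hE : CharZero E) (a b : ℚˣ) {x y : E} (hxy : (W.baseChange E).toAffine.Equation x y)
    (hx₁ : x ≠ algebraMap ℚ E e₁) (hx₂ : x ≠ algebraMap ℚ E e₂)
    (ha : IsSquare (algebraMap ℚ E (a : ℚ) * ((algebraMap ℚ E e₂ - algebraMap ℚ E e₁) * (x - algebraMap ℚ E e₁))))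
    (hb : IsSquare (algebraMap ℚ E (b : ℚ) *
      ((algebraMap ℚ E e₂ - algebraMap ℚ E e₁) * (algebraMap ℚ E e₂ - algebraMap ℚ E e₃) * (x - algebraMap ℚ E e₂)))) :
    W.twoDescentClass h a b ∈ selmerLocalKer W E 2 := by
  haveI := hE
  haveI := W.isElliptic_baseChange E
  have hh := h.map E
  have hns : (W.baseChange E).toAffine.Nonsingular x y := ((W.baseChange E).toAffine.equation_iff_nonsingular).mp hxy
  set P : (W.baseChange E).toAffine.Point := Point.some _ _ hns with hP
  set Q : (W.baseChange E).toAffine.Point := Point.some _ _ (nonsingular_twoTorsion hh.swap₁₂) with hQ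
  refine W.mem_selmerLocalKer_of_twoDescentComponent_eq E h a b (W.kummerEquiv_twoTorsionCharH1_twoDescentClass h a b)
    (W.kummerEquiv_twoTorsionCharH1_swap_twoDescentClass h a b) (P + Q) ?_ ?_
  · rw [twoDescentComponent_add hh, hP, hQ, twoDescentComponent_some_of_ne _ hx₁,
      twoDescentComponent_some_of_ne _ hh.swap₁₂.ne₁₂, ← sqClass_mul (sub_ne_zero.mpr hx₁) (sub_ne_zero.mpr hh.swap₁₂.ne₁₂),
      mk_unitsMap_eq_sqClass_of_isSquare a (mul_ne_zero (sub_ne_zero.mpr hx₁) (sub_ne_zero.mpr hh.swap₁₂.ne₁₂))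
        (by rw [mul_comm (x - _)]; exact ha)]
  · rw [twoDescentComponent_add hh.swap₁₂, hP, hQ, twoDescentComponent_some_of_ne _ hx₂,
      twoDescentComponent_some_of_eq _ rfl, ← sqClass_mul (sub_ne_zero.mpr hx₂) hh.swap₁₂.c_ne_zero,
      mk_unitsMap_eq_sqClass_of_isSquare b (mul_ne_zero (sub_ne_zero.mpr hx₂) hh.swap₁₂.c_ne_zero)
        (by rw [mul_comm (x - _)]; exact hb)]

end TwoDescentLocal

namespace CongruentNumberTwoDescent

variable {n : ℕ} [hE : (congruentNumberCurve n).IsElliptic]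

/-- `ℚ_v` has characteristic zero (a term, deliberately NOT a local instance). [folklore] -/
private theorem charZero_adicCompletion_rat (v : HeightOneSpectrum (𝓞 ℚ)) : CharZero (v.adicCompletion ℚ) :=
  charZero_of_injective_algebraMap (algebraMap ℚ (v.adicCompletion ℚ)).injective

/-- `v₂(2) = 1`. [folklore] -/
private theorem padicValRat_two_two : padicValRat 2 (2 : ℚ) = 1 := by
  have h := padicValRat.self (p := 2) one_lt_two
  simpa using h

/-! ## §1 `T₂` at the prime `2`, `n` odd -/

/-- **The prime `2`, `n` odd, case `([a]₂, [b]₂) = ([n], [−1])`**: for `a, b` with `v₂(a) = v₂(b) = 0`,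
`res8 (a·n) = 1` and `res8 (−b) = 1`, `c(a, b)` satisfies the local Selmer condition at the place above `2` (the
torsion point `T₂ = (0,0)`, descent values `(n, −n²)`). [cite: SilvermanAEC2009, Prop. X.1.4, Example X.1.5]
[cite: Serre1973, Ch. II §3.3 Thm 4] -/
theorem twoDescentClass_mem_selmerLocalKer_two_of_T₂_res8 (hn2 : n % 2 = 1) (v : HeightOneSpectrum (𝓞 ℚ))
    (hv : (primesEquiv v : ℕ) = 2) (a b : ℚˣ) (hva : padicValRat 2 (a : ℚ) = 0) (hvb : padicValRat 2 (b : ℚ) = 0)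
    (h8a : res8 ((a : ℚ) * n) = 1) (h8b : res8 (-(b : ℚ)) = 1) :
    (congruentNumberCurve n).twoDescentClass (splitTwoTorsion_cn n) a b ∈
      selmerLocalKer (congruentNumberCurve n) (v.adicCompletion ℚ) 2 := by
  haveI : Fact (Nat.Prime 2) := ⟨Nat.prime_two⟩
  have hnodd : ¬ (2 : ℤ) ∣ (n : ℤ) := by omega
  have hn0 : (n : ℚ) ≠ 0 := by exact_mod_cast (show n ≠ 0 by omega)
  have hvn : padicValRat 2 (n : ℚ) = 0 := by
    rw [show (n : ℚ) = ((n : ℤ) : ℚ) by push_cast; rfl]; exact padicValRat_intCast_eq_zero hnodd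
  refine twoDescentClass_mem_selmerLocalKer_of_isSquare_T₂ (congruentNumberCurve n) (splitTwoTorsion_cn n) _
    (charZero_adicCompletion_rat v) a b ?_ ?_
  · rw [show (0 : ℚ) - -(n : ℚ) = n by ring]
    refine isSquare_algebraMap_adicCompletion_two_of_res8 v hv (mul_ne_zero a.ne_zero hn0) ?_ h8a
    rw [padicValRat.mul a.ne_zero hn0, hva, hvn]; exact ⟨0, rfl⟩
  · rw [show ((0 : ℚ) - -(n : ℚ)) * (0 - (n : ℚ)) = -((n : ℚ) * n) by ring, mul_neg, ← neg_mul]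
    refine isSquare_algebraMap_adicCompletion_two_of_res8 v hv (mul_ne_zero (neg_ne_zero.mpr b.ne_zero) (mul_ne_zero hn0 hn0)) ?_ ?_
    · rw [padicValRat.mul (neg_ne_zero.mpr b.ne_zero) (mul_ne_zero hn0 hn0), padicValRat.neg, hvb,
        padicValRat.mul hn0 hn0, hvn]; exact ⟨0, rfl⟩
    · rw [res8_mul (neg_ne_zero.mpr b.ne_zero) (mul_ne_zero hn0 hn0), h8b, one_mul, res8_mul hn0 hn0, res8_mul_self hn0]

/-! ## §2 The `2`-adic point `G = (1/4, √(1 − 16n²)/8)` and `G + T₂`, `n` odd -/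

omit hE in
/-- **The `2`-adic square root of `1 − 16n²`** (`≡ 1 (mod 8)`), realised in `ℚ_v`, `v ∣ 2`.
[cite: Serre1973, Ch. II §3.3 Thm 4] -/
theorem exists_mul_self_eq_two_odd (v : HeightOneSpectrum (𝓞 ℚ)) (hv : (primesEquiv v : ℕ) = 2) :
    ∃ z : v.adicCompletion ℚ, algebraMap ℚ (v.adicCompletion ℚ) (1 - 16 * (n : ℚ) ^ 2) = z * z := by
  haveI : Fact (Nat.Prime 2) := ⟨Nat.prime_two⟩
  have hsq : IsSquare (algebraMap ℚ (v.adicCompletion ℚ) (((1 : ℤ) - 16 * (n : ℤ) ^ 2 : ℤ) : ℚ)) := by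
    apply isSquare_algebraMap_adicCompletion_of_padic' v hv
    rw [Rat.cast_intCast]
    refine padic_isSquare_intCast_of_mod_eight rfl ?_
    have : (1 : ℤ) - 16 * (n : ℤ) ^ 2 = 8 * (-2 * (n : ℤ) ^ 2) + 1 := by ring
    rw [this]; omega
  obtain ⟨z, hz⟩ := hsq
  refine ⟨z, ?_⟩
  rw [← hz]; congr 1; push_cast; ring

omit hE in
/-- The point `G = (1/4, y/8)` with `y² = 1 − 16n²` lies on `E_n` over `ℚ_v` (`(y/8)² = (1/4)³ − n²(1/4)`).
[cite: SilvermanAEC2009, Example X.1.5] -/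
private theorem equation_G (v : HeightOneSpectrum (𝓞 ℚ)) {z : v.adicCompletion ℚ}
    (hz : algebraMap ℚ (v.adicCompletion ℚ) (1 - 16 * (n : ℚ) ^ 2) = z * z) :
    ((congruentNumberCurve n).baseChange (v.adicCompletion ℚ)).toAffine.Equation
      (algebraMap ℚ (v.adicCompletion ℚ) (1 / 4)) (z * algebraMap ℚ (v.adicCompletion ℚ) (1 / 8)) := by
  set W := congruentNumberCurve n with hW
  rw [WeierstrassCurve.Affine.equation_iff]
  have e1 : (W.baseChange (v.adicCompletion ℚ)).toAffine.a₁ = 0 := by rw [hW]; simp [WeierstrassCurve.baseChange]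
  have e2 : (W.baseChange (v.adicCompletion ℚ)).toAffine.a₂ = 0 := by rw [hW]; simp [WeierstrassCurve.baseChange]
  have e3 : (W.baseChange (v.adicCompletion ℚ)).toAffine.a₃ = 0 := by rw [hW]; simp [WeierstrassCurve.baseChange]
  have e4 : (W.baseChange (v.adicCompletion ℚ)).toAffine.a₄ = algebraMap ℚ (v.adicCompletion ℚ) (-((n : ℚ) ^ 2)) := by
    rw [hW]; simp [WeierstrassCurve.baseChange]
  have e6 : (W.baseChange (v.adicCompletion ℚ)).toAffine.a₆ = 0 := by rw [hW]; simp [WeierstrassCurve.baseChange]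
  rw [e1, e2, e3, e4, e6]
  simp only [zero_mul, add_zero]
  rw [show (z * algebraMap ℚ (v.adicCompletion ℚ) (1 / 8)) ^ 2 = (z * z) * algebraMap ℚ (v.adicCompletion ℚ) ((1 / 8) ^ 2)
      by rw [map_pow]; ring, ← hz, ← map_mul, ← map_pow, ← map_mul, ← map_add]
  congr 1
  ring

/-- **The prime `2`, `n` odd, case `([a]₂, [b]₂) = ([5], [1])`**: for `a, b` with `v₂ = 0`, `res8 (a·(1 + 4n)) = 1`
and `res8 b = 1`, `c(a, b)` satisfies the local Selmer condition at the place above `2` — the descent pair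
`(1/4 + n, 1/4) ≡ (1 + 4n, 1)` of the `2`-adic point `G = (1/4, √(1−16n²)/8)` (`1 + 4n ≡ 5 (mod 8)`).
[cite: SilvermanAEC2009, Prop. X.1.4, Example X.1.5] [cite: Serre1973, Ch. II §3.3 Thm 4] -/
theorem twoDescentClass_mem_selmerLocalKer_two_of_G_res8 (v : HeightOneSpectrum (𝓞 ℚ))
    (hv : (primesEquiv v : ℕ) = 2) (a b : ℚˣ) (hva : padicValRat 2 (a : ℚ) = 0) (hvb : padicValRat 2 (b : ℚ) = 0)
    (h8a : res8 ((a : ℚ) * (1 + 4 * n)) = 1) (h8b : res8 (b : ℚ) = 1) :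
    (congruentNumberCurve n).twoDescentClass (splitTwoTorsion_cn n) a b ∈
      selmerLocalKer (congruentNumberCurve n) (v.adicCompletion ℚ) 2 := by
  haveI : Fact (Nat.Prime 2) := ⟨Nat.prime_two⟩
  set W := congruentNumberCurve n with hW
  set K := v.adicCompletion ℚ
  obtain ⟨z, hz⟩ := exists_mul_self_eq_two_odd (n := n) v hv
  have heq := equation_G (n := n) v hz
  have hinj := (algebraMap ℚ K).injective
  have hx₁ : algebraMap ℚ K (1 / 4) ≠ algebraMap ℚ K (-(n : ℚ)) := by
    intro h; have h' := hinj h; have : (0 : ℚ) ≤ n := Nat.cast_nonneg n; linarith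
  have hx₂ : algebraMap ℚ K (1 / 4) ≠ algebraMap ℚ K 0 := by
    intro h; have h' := hinj h; norm_num at h'
  have h14n : (1 : ℚ) + 4 * n ≠ 0 := by positivity
  have hodd14 : ¬ (2 : ℤ) ∣ (1 + 4 * (n : ℤ)) := by omega
  have sqa : IsSquare (algebraMap ℚ K (a : ℚ) * (algebraMap ℚ K (1 / 4) - algebraMap ℚ K (-(n : ℚ)))) := by
    rw [← map_sub, ← map_mul, show (1 / 4 : ℚ) - -(n : ℚ) = (2 : ℚ) ^ (-2 : ℤ) * (1 + 4 * n) by ring, ← mul_assoc,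
      mul_comm (a : ℚ), mul_assoc]
    refine isSquare_algebraMap_adicCompletion_two_of_res8 v hv
      (mul_ne_zero (zpow_ne_zero _ two_ne_zero) (mul_ne_zero a.ne_zero h14n)) ?_ ?_
    · rw [padicValRat.mul (zpow_ne_zero _ two_ne_zero) (mul_ne_zero a.ne_zero h14n), padicValRat.zpow (2 : ℚ),
        padicValRat_two_two, padicValRat.mul a.ne_zero h14n, hva,
        show (1 : ℚ) + 4 * n = ((1 + 4 * (n : ℤ) : ℤ) : ℚ) by push_cast; ring, padicValRat_intCast_eq_zero hodd14]
      exact ⟨-1, by norm_num⟩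
    · rw [res8_two_zpow_mul _ (mul_ne_zero a.ne_zero h14n), h8a]
  have sqb : IsSquare (algebraMap ℚ K (b : ℚ) * (algebraMap ℚ K (1 / 4) - algebraMap ℚ K 0)) := by
    rw [← map_sub, ← map_mul, sub_zero, show (1 / 4 : ℚ) = (2 : ℚ) ^ (-2 : ℤ) * 1 by norm_num, ← mul_assoc,
      mul_comm (b : ℚ), mul_assoc, mul_one]
    refine isSquare_algebraMap_adicCompletion_two_of_res8 v hv (mul_ne_zero (zpow_ne_zero _ two_ne_zero) b.ne_zero) ?_ ?_
    · rw [padicValRat.mul (zpow_ne_zero _ two_ne_zero) b.ne_zero, padicValRat.zpow (2 : ℚ),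
        padicValRat_two_two, hvb]
      exact ⟨-1, by norm_num⟩
    · rw [res8_two_zpow_mul _ b.ne_zero, h8b]
  exact twoDescentClass_mem_selmerLocalKer_of_equation W (splitTwoTorsion_cn n) _ (charZero_adicCompletion_rat v) a b
    heq hx₁ hx₂ sqa sqb

/-- **The prime `2`, `n` odd, case `([a]₂, [b]₂) = ([5n], [−1])`**: for `a, b` with `v₂ = 0`,
`res8 (a·n·(1 + 4n)) = 1` and `res8 (−b) = 1`, `c(a, b)` satisfies the local Selmer condition at the place above
`2` — the descent pair `(n(1/4 + n), −n²/4)` of `G + T₂`. [cite: SilvermanAEC2009, Prop. X.1.4, Example X.1.5]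
[cite: Serre1973, Ch. II §3.3 Thm 4] -/
theorem twoDescentClass_mem_selmerLocalKer_two_of_GT₂_res8 (hn2 : n % 2 = 1) (v : HeightOneSpectrum (𝓞 ℚ))
    (hv : (primesEquiv v : ℕ) = 2) (a b : ℚˣ) (hva : padicValRat 2 (a : ℚ) = 0) (hvb : padicValRat 2 (b : ℚ) = 0)
    (h8a : res8 ((a : ℚ) * n * (1 + 4 * n)) = 1) (h8b : res8 (-(b : ℚ)) = 1) :
    (congruentNumberCurve n).twoDescentClass (splitTwoTorsion_cn n) a b ∈
      selmerLocalKer (congruentNumberCurve n) (v.adicCompletion ℚ) 2 := by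
  haveI : Fact (Nat.Prime 2) := ⟨Nat.prime_two⟩
  set W := congruentNumberCurve n with hW
  set K := v.adicCompletion ℚ
  have hnodd : ¬ (2 : ℤ) ∣ (n : ℤ) := by omega
  have hn0 : (n : ℚ) ≠ 0 := by exact_mod_cast (show n ≠ 0 by omega)
  have hvn : padicValRat 2 (n : ℚ) = 0 := by
    rw [show (n : ℚ) = ((n : ℤ) : ℚ) by push_cast; rfl]; exact padicValRat_intCast_eq_zero hnodd
  obtain ⟨z, hz⟩ := exists_mul_self_eq_two_odd (n := n) v hv
  have heq := equation_G (n := n) v hz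
  have hinj := (algebraMap ℚ K).injective
  have hx₁ : algebraMap ℚ K (1 / 4) ≠ algebraMap ℚ K (-(n : ℚ)) := by
    intro h; have h' := hinj h; have : (0 : ℚ) ≤ n := Nat.cast_nonneg n; linarith
  have hx₂ : algebraMap ℚ K (1 / 4) ≠ algebraMap ℚ K 0 := by
    intro h; have h' := hinj h; norm_num at h'
  have h14n : (1 : ℚ) + 4 * n ≠ 0 := by positivity
  have hodd14 : ¬ (2 : ℤ) ∣ (1 + 4 * (n : ℤ)) := by omega
  have sqa : IsSquare (algebraMap ℚ K (a : ℚ) *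
      ((algebraMap ℚ K 0 - algebraMap ℚ K (-(n : ℚ))) * (algebraMap ℚ K (1 / 4) - algebraMap ℚ K (-(n : ℚ))))) := by
    rw [← map_sub, ← map_sub, ← map_mul, ← map_mul,
      show (a : ℚ) * ((0 - -(n : ℚ)) * (1 / 4 - -(n : ℚ))) = (2 : ℚ) ^ (-2 : ℤ) * ((a : ℚ) * n * (1 + 4 * n)) by ring]
    have hne : (a : ℚ) * n * (1 + 4 * n) ≠ 0 := mul_ne_zero (mul_ne_zero a.ne_zero hn0) h14n
    refine isSquare_algebraMap_adicCompletion_two_of_res8 v hv (mul_ne_zero (zpow_ne_zero _ two_ne_zero) hne) ?_ ?_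
    · rw [padicValRat.mul (zpow_ne_zero _ two_ne_zero) hne, padicValRat.zpow (2 : ℚ), padicValRat_two_two,
        padicValRat.mul (mul_ne_zero a.ne_zero hn0) h14n, padicValRat.mul a.ne_zero hn0, hva, hvn,
        show (1 : ℚ) + 4 * n = ((1 + 4 * (n : ℤ) : ℤ) : ℚ) by push_cast; ring, padicValRat_intCast_eq_zero hodd14]
      exact ⟨-1, by norm_num⟩
    · rw [res8_two_zpow_mul _ hne, h8a]
  have sqb : IsSquare (algebraMap ℚ K (b : ℚ) *
      ((algebraMap ℚ K 0 - algebraMap ℚ K (-(n : ℚ))) * (algebraMap ℚ K 0 - algebraMap ℚ K (n : ℚ)) *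
        (algebraMap ℚ K (1 / 4) - algebraMap ℚ K 0))) := by
    rw [← map_sub, ← map_sub, ← map_sub, ← map_mul, ← map_mul, ← map_mul,
      show (b : ℚ) * ((0 - -(n : ℚ)) * (0 - (n : ℚ)) * (1 / 4 - 0)) = (2 : ℚ) ^ (-2 : ℤ) * (-(b : ℚ) * ((n : ℚ) * n)) by ring]
    have hne : -(b : ℚ) * ((n : ℚ) * n) ≠ 0 := mul_ne_zero (neg_ne_zero.mpr b.ne_zero) (mul_ne_zero hn0 hn0)
    refine isSquare_algebraMap_adicCompletion_two_of_res8 v hv (mul_ne_zero (zpow_ne_zero _ two_ne_zero) hne) ?_ ?_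
    · rw [padicValRat.mul (zpow_ne_zero _ two_ne_zero) hne, padicValRat.zpow (2 : ℚ), padicValRat_two_two,
        padicValRat.mul (neg_ne_zero.mpr b.ne_zero) (mul_ne_zero hn0 hn0), padicValRat.neg, hvb,
        padicValRat.mul hn0 hn0, hvn]
      exact ⟨-1, by norm_num⟩
    · rw [res8_two_zpow_mul _ hne, res8_mul (neg_ne_zero.mpr b.ne_zero) (mul_ne_zero hn0 hn0), h8b, one_mul,
        res8_mul hn0 hn0, res8_mul_self hn0]
  exact TwoDescentLocal.twoDescentClass_mem_selmerLocalKer_of_equation_add_T₂ W (splitTwoTorsion_cn n) _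
    (charZero_adicCompletion_rat v) a b heq hx₁ hx₂ sqa sqb

end CongruentNumberTwoDescent

end Literature.NumberTheory.EllipticCurves

end
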